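import Summits.Ventures.PercRepro.Support
import Summits.Ventures.PercRepro.DecisionTreeHK

/-!
# The Cauchy–Schwarz form of the decision-tree inequality (Gladkov, Theorem 5.2)

Let `t₁` be a decision tree all of whose nodes send their edges to `S` and which *decides* the
event `A` (at every leaf, membership in `A` is determined by the states of the queried edges),
let `t₂` continue `t₁` (`t₁` is a prefix of `t₂`), and let `B = A ∩ M` with `M` increasing.
Then, with `S = run t₂ ω ω'` (Gladkov, arXiv:2408.08457, Theorem 5.2):
`P(B)² ≤ P(A) · P(ω ∈ B ∧ ω →_S ω' ∈ B)` (`DTree.cauchy_schwarz`).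

Proof by induction on `t₁` (`DTree.cs_aux`), with the queried set `Q`, two weight vectors
deterministic on `Q` and equal off `Q` (the conditional laws of the two copies along the path),
and `S₀ = Q` (every queried edge went to `S`).  At a leaf of `t₁`, `A` is almost surely constant;
if it is almost surely empty there is nothing to prove, otherwise `B` and `M` coincide almost
surely in both copies (the swapped configuration agrees with `ω` on `Q`), `ω →_Q ω'` has the law
of `ω` (`expectPair_mix_det`: the queried edges are deterministic), and Theorem 3.2 for the
remaining tree gives `P(M)² ≤ E[1_M(ω) 1_M(ω →_{Q ∪ S} ω')]`.  At a node the two-copy expectation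
splits along the queried edge, the induction hypothesis bounds each cell, and the two-point
Cauchy–Schwarz inequality `u_b² ≤ a_b x_b ⇒ (Σ c_b u_b)² ≤ (Σ c_b a_b)(Σ c_b x_b)`
(`cauchy_schwarz_two_point`) recombines the cells — Gladkov's sum over the leaves with the
influences `δ(N)`, done one node at a time.
-/

namespace PercRepro

open Finset

variable {E : Type*}

/-- `DeterminedOn A Q v`: on the cylinder of configurations whose edges in `Q` have the states
`v`, membership in `A` is constant (the states of the queried edges decide `A`). -/
def DeterminedOn (A : Set (Config E)) (Q : Set E) (v : E → Bool) : Prop :=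
  ∀ ω ζ : Config E, (∀ e ∈ Q, ω e = v e) → (∀ e ∈ Q, ζ e = v e) → (ω ∈ A ↔ ζ ∈ A)

/-- `Det p Q`: the weight vector is deterministic (`0` or `1`) on `Q`. -/
def Det (p : E → ℝ) (Q : Set E) : Prop := ∀ e ∈ Q, p e = 0 ∨ p e = 1

/-- `Fixes p Q v`: the weight vector fixes the states `v` on `Q`. -/
def Fixes (p : E → ℝ) (Q : Set E) (v : E → Bool) : Prop :=
  ∀ e ∈ Q, p e = if v e then 1 else 0

namespace DTree

/-- Every node of the tree sends its edge to `S`. -/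
def AllS : DTree E → Prop
  | leaf => True
  | node _ toS next => toS = true ∧ ∀ b b', AllS (next b b')

/-- `Continues t₁ t₂`: `t₂` extends `t₁` below its leaves (same queries and decisions on the
nodes of `t₁`). -/
def Continues : DTree E → DTree E → Prop
  | leaf, _ => True
  | node _ _ _, leaf => False
  | node e toS next₁, node e' toS' next₂ =>
      e = e' ∧ toS = toS' ∧ ∀ b b', Continues (next₁ b b') (next₂ b b')

/-- `Decides t Q v A`: at every leaf of `t`, reached with the queried set `Q` and the revealed
states `v` enlarged by the path, membership in `A` is decided by the revealed states. -/
def Decides [DecidableEq E] : DTree E → Set E → (E → Bool) → Set (Config E) → Prop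
  | leaf, Q, v, A => DeterminedOn A Q v
  | node e _ next, Q, v, A => ∀ b b', Decides (next b b') (insert e Q) (Function.update v e b) A

end DTree

variable [DecidableEq E] [Fintype E]

omit [DecidableEq E] in
omit [DecidableEq E] [Fintype E] in
/-- A vector fixing states on `Q` is deterministic on `Q`. -/
theorem Fixes.det {p : E → ℝ} {Q : Set E} {v : E → Bool} (h : Fixes p Q v) : Det p Q := by
  intro e he
  rw [h e he]
  cases v e <;> simp

omit [DecidableEq E] in
/-- On the support of a vector fixing the states `v` on `Q`, the edges of `Q` carry `v`. -/
theorem eq_of_fixes {p : E → ℝ} {Q : Set E} {v : E → Bool} (h : Fixes p Q v) {ω : Config E}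
    (hω : weight p ω ≠ 0) : ∀ e ∈ Q, ω e = v e := by
  intro e he
  have := h e he
  cases hv : v e
  · rw [hv] at this; simp only [Bool.false_eq_true, if_false] at this
    exact eq_false_of_weight_ne_zero_of_eq_zero hω this
  · rw [hv] at this; simp only [if_true] at this
    exact eq_true_of_weight_ne_zero_of_eq_one hω this

/-- The support of a weight vector is nonempty (the weights sum to `1`). -/
theorem exists_weight_ne_zero (p : E → ℝ) : ∃ ω : Config E, weight p ω ≠ 0 := by
  by_contra h
  have h' : ∀ ω : Config E, weight p ω = 0 := fun ω => by_contra fun h' => h ⟨ω, h'⟩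
  have := sum_weight p
  simp only [h', Finset.sum_const_zero] at this
  exact zero_ne_one this

/-- Under a vector fixing the states `v` on `Q`, an event decided by `(Q, v)` is almost surely
constant. -/
theorem as_const_of_determinedOn {p : E → ℝ} {Q : Set E} {v : E → Bool} (hf : Fixes p Q v)
    {A : Set (Config E)} (hA : DeterminedOn A Q v) :
    (∀ ω, weight p ω ≠ 0 → ω ∈ A) ∨ (∀ ω, weight p ω ≠ 0 → ω ∉ A) := by
  obtain ⟨ω₀, h₀⟩ := exists_weight_ne_zero p
  by_cases hm : ω₀ ∈ A
  · exact Or.inl fun ω hω => (hA ω₀ ω (eq_of_fixes hf h₀) (eq_of_fixes hf hω)).mp hm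
  · exact Or.inr fun ω hω hω' => hm ((hA ω₀ ω (eq_of_fixes hf h₀) (eq_of_fixes hf hω)).mpr hω')

/-- The bit a deterministic weight fixes: `true` iff `p e = 1`. -/
noncomputable def bitOf (x : ℝ) : Bool := decide (x = 1)

omit [Fintype E] in
/-- A weight vector deterministic at `e` is its own update at `e` by the fixed bit. -/
theorem upd_bitOf_eq {p : E → ℝ} {e : E} (h : p e = 0 ∨ p e = 1) : upd p e (bitOf (p e)) = p := by
  funext e'
  by_cases he : e' = e
  · subst he
    rcases h with h0 | h1
    · simp [upd, bitOf, h0]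
    · simp [upd, bitOf, h1]
  · simp [upd, Function.update_of_ne he]

/-- On the support of a vector deterministic at `e`, the edge `e` carries the fixed bit. -/
theorem eq_bitOf_of_weight_ne_zero {p : E → ℝ} {e : E} (h : p e = 0 ∨ p e = 1) {ω : Config E}
    (hω : weight p ω ≠ 0) : ω e = bitOf (p e) := by
  rw [← upd_bitOf_eq h] at hω
  exact eq_of_weight_upd_ne_zero hω

/-- **Deterministic mixing**: if `p₁`, `p₂` are deterministic on `Q` and agree off `Q`, then
`ω →_Q ω'` (copy 1 on `Q`, copy 2 off `Q`) has the law of copy 1. -/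
theorem expectPair_mix_det (Q : Finset E) : ∀ (p₁ p₂ : E → ℝ),
    Det p₁ (↑Q) → Det p₂ (↑Q) → (∀ e, e ∉ Q → p₁ e = p₂ e) →
    ∀ g : Config E → ℝ,
      expectPair p₁ p₂ (fun ω ω' => g (mix (↑Q) ω ω')) = ∑ ω, weight p₁ ω * g ω := by
  induction Q using Finset.induction_on with
  | empty =>
    intro p₁ p₂ _ _ hoff g
    have hpe : p₂ = p₁ := funext fun e => (hoff e (Finset.notMem_empty e)).symm
    simp only [Finset.coe_empty, mix_empty, hpe]
    unfold expectPair
    have : ∀ ω : Config E, ∑ ω', weight p₁ ω * weight p₁ ω' * g ω' =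
        weight p₁ ω * ∑ ω', weight p₁ ω' * g ω' := by
      intro ω
      rw [Finset.mul_sum]
      exact Finset.sum_congr rfl fun ω' _ => by ring
    simp only [this, ← Finset.sum_mul, sum_weight, one_mul]
  | insert e Q he ih =>
    intro p₁ p₂ hd₁ hd₂ hoff g
    have hd₁e : p₁ e = 0 ∨ p₁ e = 1 := hd₁ e (by simp)
    have hd₂e : p₂ e = 0 ∨ p₂ e = 1 := hd₂ e (by simp)
    set b₁ := bitOf (p₁ e) with hb₁
    -- step 1: the first copy's bit at `e` is `b₁` almost surely
    have step1 : expectPair p₁ p₂ (fun ω ω' => g (mix (↑(insert e Q)) ω ω')) =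
        expectPair p₁ p₂ (fun ω ω' => g (Function.update (mix (↑Q) ω ω') e b₁)) := by
      refine expectPair_congr fun ω ω' h1 _ => ?_
      rw [Finset.coe_insert, mix_insert, eq_bitOf_of_weight_ne_zero hd₁e h1]
    -- step 2: the integrand does not look at `e`, so the second copy's fixed bit can be changed
    set p₂' : E → ℝ := upd p₂ e b₁ with hp₂'
    have step2 : expectPair p₁ p₂ (fun ω ω' => g (Function.update (mix (↑Q) ω ω') e b₁)) =
        expectPair p₁ p₂' (fun ω ω' => g (Function.update (mix (↑Q) ω ω') e b₁)) := by
      have e1 := upd_bitOf_eq hd₁e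
      have e2 := upd_bitOf_eq hd₂e
      conv_lhs => rw [← e1, ← e2]
      conv_rhs => rw [← e1]
      rw [hp₂']
      exact expectPair_upd_eq (fun ω ω' x => by rw [update_mix_update_left])
        (fun ω ω' x => by rw [update_mix_update_right]) _ _ _ _
    -- step 3: the induction hypothesis for `Q` with `g' = g ∘ (·[e := b₁])`
    have hd₂' : Det p₂' (↑Q) := by
      intro e' he'
      have hne : e' ≠ e := fun h => he (h ▸ he')
      rw [hp₂']; simp only [upd, Function.update_of_ne hne]
      exact hd₂ e' (by simp [he'])
    have hoff' : ∀ e', e' ∉ Q → p₁ e' = p₂' e' := by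
      intro e' he'
      by_cases h : e' = e
      · subst h
        rw [hp₂']; simp only [upd, Function.update_self]
        rcases hd₁e with h0 | h1
        · simp [hb₁, bitOf, h0]
        · simp [hb₁, bitOf, h1]
      · rw [hp₂']; simp only [upd, Function.update_of_ne h]
        exact hoff e' (by simp [h, he'])
    have hd₁' : Det p₁ (↑Q) := fun e' he' => hd₁ e' (by simp [he'])
    have step3 := ih p₁ p₂' hd₁' hd₂' hoff' (fun ζ => g (Function.update ζ e b₁))
    -- step 4: on the support of `p₁`, `ω[e := b₁] = ω`
    have step4 : ∑ ω, weight p₁ ω * g (Function.update ω e b₁) = ∑ ω, weight p₁ ω * g ω := by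
      refine Finset.sum_congr rfl fun ω _ => ?_
      by_cases h : weight p₁ ω = 0
      · simp [h]
      · have hω : ω e = b₁ := eq_bitOf_of_weight_ne_zero hd₁e h
        rw [← hω, Function.update_eq_self]
    rw [step1, step2, step3, step4]

/-- The two-point Cauchy–Schwarz inequality: if `u_b² ≤ a_b x_b` with `a_b, x_b ≥ 0`, then for
weights `c_b ≥ 0`, `(Σ c_b u_b)² ≤ (Σ c_b a_b)(Σ c_b x_b)`. -/
theorem cauchy_schwarz_two_point {c₀ c₁ a₀ a₁ x₀ x₁ u₀ u₁ : ℝ} (hc₀ : 0 ≤ c₀) (hc₁ : 0 ≤ c₁)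
    (ha₀ : 0 ≤ a₀) (ha₁ : 0 ≤ a₁) (hx₀ : 0 ≤ x₀) (hx₁ : 0 ≤ x₁)
    (h₀ : u₀ ^ 2 ≤ a₀ * x₀) (h₁ : u₁ ^ 2 ≤ a₁ * x₁) :
    (c₀ * u₀ + c₁ * u₁) ^ 2 ≤ (c₀ * a₀ + c₁ * a₁) * (c₀ * x₀ + c₁ * x₁) := by
  have hs : 0 ≤ a₀ * x₁ + a₁ * x₀ := by positivity
  have hprod : (u₀ * u₁) ^ 2 ≤ (a₀ * x₀) * (a₁ * x₁) := by
    rw [mul_pow]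
    exact mul_le_mul h₀ h₁ (sq_nonneg _) (by positivity)
  have hsq : (2 * (u₀ * u₁)) ^ 2 ≤ (a₀ * x₁ + a₁ * x₀) ^ 2 := by
    nlinarith [sq_nonneg (a₀ * x₁ - a₁ * x₀), hprod]
  have key : 2 * (u₀ * u₁) ≤ a₀ * x₁ + a₁ * x₀ :=
    (le_abs_self _).trans (abs_le_of_sq_le_sq hsq hs)
  nlinarith [mul_nonneg hc₀ hc₁, mul_le_mul_of_nonneg_left h₀ (sq_nonneg c₀),
    mul_le_mul_of_nonneg_left h₁ (sq_nonneg c₁), mul_le_mul_of_nonneg_left key (mul_nonneg hc₀ hc₁)]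

/-- `P(A) = E[1_A]` as a weighted sum. -/
theorem prob_eq_sum_weight_mul_indicator (p : E → ℝ) (A : Set (Config E)) :
    prob p A = ∑ ω, weight p ω * A.indicator 1 ω := by
  unfold prob
  refine Finset.sum_congr rfl fun ω _ => ?_
  by_cases h : ω ∈ A <;> simp [h]

/-- Two-copy expectations of nonnegative integrands are nonnegative. -/
theorem expectPair_nonneg {p₁ p₂ : E → ℝ} (hp₁ : IsProb p₁) (hp₂ : IsProb p₂)
    {F : Config E → Config E → ℝ} (h : ∀ ω ω', 0 ≤ F ω ω') : 0 ≤ expectPair p₁ p₂ F := by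
  unfold expectPair
  exact Finset.sum_nonneg fun ω _ => Finset.sum_nonneg fun ω' _ =>
    mul_nonneg (mul_nonneg (weight_nonneg hp₁ ω) (weight_nonneg hp₂ ω')) (h ω ω')

/-- The inductive statement behind Theorem 5.2: `t₁` an all-`S` tree deciding `A` below the
queried set `Q`, `t₂` a continuation, the two laws deterministic on `Q` and equal off `Q`,
`B = A ∩ M` with `M` increasing:
`P_{p₁}(B)² ≤ P_{p₁}(A) · E[1_B(ω) · 1_B(ω →_{Q ∪ run t₂ ω ω'} ω')]`. -/
theorem DTree.cs_aux (t₁ : DTree E) : ∀ (t₂ : DTree E) (Q : Finset E) (v : E → Bool)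
    (p₁ p₂ : E → ℝ),
    AllS t₁ → Continues t₁ t₂ → Proper t₂ (↑Q) → IsProb p₁ → IsProb p₂ →
    Fixes p₁ (↑Q) v → Det p₂ (↑Q) → (∀ e, e ∉ Q → p₁ e = p₂ e) →
    ∀ {A M : Set (Config E)}, Decides t₁ (↑Q) v A → IsUpperSet M →
      prob p₁ (A ∩ M) ^ 2 ≤
        prob p₁ A * expectPair p₁ p₂ (fun ω ω' => (A ∩ M).indicator 1 ω *
          (A ∩ M).indicator 1 (mix (↑Q ∪ run t₂ ω ω') ω ω')) := by
  induction t₁ with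
  | leaf =>
    intro t₂ Q v p₁ p₂ _ _ ht₂ hp₁ hp₂ hf₁ hd₂ hoff A M hdec hM
    have hd₁ : Det p₁ (↑Q) := hf₁.det
    have hdet : DeterminedOn A (↑Q) v := hdec
    rcases as_const_of_determinedOn hf₁ hdet with hfull | hempty
    · -- `A` is almost sure: `B` is `M` almost surely, in both copies
      have hA1 : prob p₁ A = 1 := prob_eq_one_of_forall_mem p₁ hfull
      have hB : prob p₁ (A ∩ M) = prob p₁ M :=
        prob_congr_of_support p₁ fun ω hω => ⟨fun h => h.2, fun h => ⟨hfull ω hω, h⟩⟩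
      have hE : expectPair p₁ p₂ (fun ω ω' => (A ∩ M).indicator 1 ω *
            (A ∩ M).indicator 1 (mix (↑Q ∪ run t₂ ω ω') ω ω')) =
          expectPair p₁ p₂ (fun ω ω' => M.indicator 1 ω *
            M.indicator 1 (mix (↑Q ∪ run t₂ ω ω') ω ω')) := by
        refine expectPair_congr fun ω ω' h1 _ => ?_
        have hωA : ω ∈ A := hfull ω h1
        have hΦA : mix (↑Q ∪ run t₂ ω ω') ω ω' ∈ A := by
          refine (hdet ω _ (eq_of_fixes hf₁ h1) fun e he => ?_).mp hωA
          rw [mix_apply_of_mem (Set.mem_union_left _ he)]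
          exact eq_of_fixes hf₁ h1 e he
        have e1 : (A ∩ M).indicator (1 : Config E → ℝ) ω = M.indicator 1 ω := by
          by_cases hm : ω ∈ M
          · rw [Set.indicator_of_mem (Set.mem_inter hωA hm), Set.indicator_of_mem hm]
          · rw [Set.indicator_of_notMem fun h => hm h.2, Set.indicator_of_notMem hm]
        have e2 : (A ∩ M).indicator (1 : Config E → ℝ) (mix (↑Q ∪ run t₂ ω ω') ω ω') =
            M.indicator 1 (mix (↑Q ∪ run t₂ ω ω') ω ω') := by
          by_cases hm : mix (↑Q ∪ run t₂ ω ω') ω ω' ∈ M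
          · rw [Set.indicator_of_mem (Set.mem_inter hΦA hm), Set.indicator_of_mem hm]
          · rw [Set.indicator_of_notMem fun h => hm h.2, Set.indicator_of_notMem hm]
        rw [e1, e2]
      have hk := DTree.hk_aux t₂ (↑Q) (↑Q) p₁ p₂ ht₂ hp₁ hp₂ hoff (Set.Subset.refl _) hM hM
      have hmixdet : expectPair p₁ p₂ (fun ω ω' => M.indicator 1 (mix (↑Q) ω ω')) = prob p₁ M := by
        rw [expectPair_mix_det Q p₁ p₂ hd₁ hd₂ hoff (M.indicator 1), prob_eq_sum_weight_mul_indicator]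
      rw [hmixdet] at hk
      rw [hA1, hB, hE, one_mul, sq]
      exact hk
    · -- `A` is almost surely empty: the left-hand side vanishes
      have hB : prob p₁ (A ∩ M) = 0 :=
        prob_eq_zero_of_forall_weight_eq_zero p₁ fun ω hω =>
          by_contra fun h => hempty ω h hω.1
      rw [hB]
      simp only [ne_eq, OfNat.ofNat_ne_zero, not_false_eq_true, zero_pow]
      refine mul_nonneg (prob_nonneg hp₁ A) (expectPair_nonneg hp₁ hp₂ fun ω ω' => ?_)
      exact mul_nonneg (Set.indicator_nonneg (fun _ _ => zero_le_one) _)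
        (Set.indicator_nonneg (fun _ _ => zero_le_one) _)
  | node e toS next₁ ih =>
    intro t₂ Q v p₁ p₂ hall hcont ht₂ hp₁ hp₂ hf₁ hd₂ hoff A M hdec hM
    obtain ⟨htoS, hall'⟩ := hall
    subst htoS
    cases t₂ with
    | leaf => exact absurd hcont id
    | node e' toS' next₂ =>
      obtain ⟨rfl, rfl, hcont'⟩ := hcont
      obtain ⟨heQ, hnext⟩ := ht₂
      have heQ' : e ∉ Q := fun h => heQ (Finset.mem_coe.mpr h)
      set B := A ∩ M with hBdef
      -- cells
      have hcell : ∀ b b' : Bool,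
          prob (upd p₁ e b) B ^ 2 ≤ prob (upd p₁ e b) A *
            expectPair (upd p₁ e b) (upd p₂ e b')
              (fun ω ω' => B.indicator 1 ω *
                B.indicator 1 (mix (↑Q ∪ run (node e true next₂) ω ω') ω ω')) := by
        intro b b'
        have hf₁' : Fixes (upd p₁ e b) (↑(insert e Q)) (Function.update v e b) := by
          intro e' he'
          by_cases h : e' = e
          · subst h; simp [upd]
          · simp only [upd, Function.update_of_ne h]
            exact hf₁ e' (by simpa [h] using he')
        have hd₂' : Det (upd p₂ e b') (↑(insert e Q)) := by
          intro e' he'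
          by_cases h : e' = e
          · subst h; cases b' <;> simp [upd]
          · simp only [upd, Function.update_of_ne h]
            exact hd₂ e' (by simpa [h] using he')
        have hoff' : ∀ e', e' ∉ insert e Q → upd p₁ e b e' = upd p₂ e b' e' := by
          intro e' he'
          have hne : e' ≠ e := fun h => he' (h ▸ Finset.mem_insert_self e Q)
          have he'Q : e' ∉ Q := fun h => he' (Finset.mem_insert_of_mem h)
          simp only [upd, Function.update_of_ne hne]
          exact hoff e' he'Q
        have hP : Proper (next₂ b b') (↑(insert e Q)) := by
          rw [Finset.coe_insert]; exact hnext b b'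
        have hD : Decides (next₁ b b') (↑(insert e Q)) (Function.update v e b) A := by
          rw [Finset.coe_insert]; exact hdec b b'
        have hih := ih b b' (next₂ b b') (insert e Q) (Function.update v e b) (upd p₁ e b)
          (upd p₂ e b') (hall' b b') (hcont' b b') hP (isProb_upd hp₁ e b) (isProb_upd hp₂ e b')
          hf₁' hd₂' hoff' hD hM
        refine hih.trans (le_of_eq ?_)
        congr 1
        refine expectPair_congr fun ω ω' h1 h2 => ?_
        have hω : ω e = b := eq_of_weight_upd_ne_zero h1
        have hω' : ω' e = b' := eq_of_weight_upd_ne_zero h2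
        simp only [run, hω, hω', if_true, Finset.coe_insert, Set.insert_eq, Set.union_assoc]
        rw [Set.union_left_comm]
      -- assemble with the two-point Cauchy–Schwarz inequality
      have hcf : ∀ (p : E → ℝ) (b : Bool), IsProb p → 0 ≤ cf p e b := by
        intro p b hp
        unfold cf
        split_ifs
        · exact hp.nonneg e
        · exact hp.one_sub_nonneg e
      set X : Bool → Bool → ℝ := fun b b' => expectPair (upd p₁ e b) (upd p₂ e b')
        (fun ω ω' => B.indicator 1 ω *
          B.indicator 1 (mix (↑Q ∪ run (node e true next₂) ω ω') ω ω')) with hX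
      set x : Bool → ℝ := fun b => ∑ b' : Bool, cf p₂ e b' * X b b' with hx
      have hux : ∀ b : Bool, prob (upd p₁ e b) B ^ 2 ≤ prob (upd p₁ e b) A * x b := by
        intro b
        have : prob (upd p₁ e b) B ^ 2 = ∑ b' : Bool, cf p₂ e b' * prob (upd p₁ e b) B ^ 2 := by
          rw [← Finset.sum_mul, sum_cf, one_mul]
        rw [this, hx]
        simp only
        rw [Finset.mul_sum]
        refine Finset.sum_le_sum fun b' _ => ?_
        calc cf p₂ e b' * prob (upd p₁ e b) B ^ 2
            ≤ cf p₂ e b' * (prob (upd p₁ e b) A * X b b') :=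
              mul_le_mul_of_nonneg_left (hcell b b') (hcf p₂ b' hp₂)
          _ = prob (upd p₁ e b) A * (cf p₂ e b' * X b b') := by ring
      have hxnn : ∀ b, 0 ≤ x b := by
        intro b
        rw [hx]
        refine Finset.sum_nonneg fun b' _ => mul_nonneg (hcf p₂ b' hp₂) ?_
        exact expectPair_nonneg (isProb_upd hp₁ e b) (isProb_upd hp₂ e b') fun ω ω' =>
          mul_nonneg (Set.indicator_nonneg (fun _ _ => zero_le_one) _)
            (Set.indicator_nonneg (fun _ _ => zero_le_one) _)
      have hsplitE : expectPair p₁ p₂ (fun ω ω' => B.indicator 1 ω *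
            B.indicator 1 (mix (↑Q ∪ run (node e true next₂) ω ω') ω ω')) =
          ∑ b : Bool, cf p₁ e b * x b := by
        rw [expectPair_split p₁ p₂ e, hx]
        simp only
        refine Finset.sum_congr rfl fun b _ => ?_
        rw [Finset.mul_sum]
        refine Finset.sum_congr rfl fun b' _ => ?_
        rw [hX]; ring
      rw [hsplitE, prob_eq_sum_cf p₁ e B, prob_eq_sum_cf p₁ e A]
      simp only [Fintype.sum_bool]
      exact cauchy_schwarz_two_point (hcf p₁ true hp₁) (hcf p₁ false hp₁)
        (prob_nonneg (isProb_upd hp₁ e true) A) (prob_nonneg (isProb_upd hp₁ e false) A)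
        (hxnn true) (hxnn false) (hux true) (hux false)

/-- **Gladkov's Theorem 5.2**: for an all-`S` decision tree `t₁` deciding `A`, a continuation
`t₂` (proper), and `B = A ∩ M` with `M` increasing,
`P(B)² ≤ P(A) · P(ω ∈ B ∧ ω →_{run t₂ ω ω'} ω' ∈ B)`. -/
theorem DTree.cauchy_schwarz {p : E → ℝ} (hp : IsProb p) {t₁ t₂ : DTree E} (h₁ : AllS t₁)
    (hc : Continues t₁ t₂) (ht₂ : Proper t₂ ∅) {A M : Set (Config E)}
    (hdec : Decides t₁ ∅ (fun _ => false) A) (hM : IsUpperSet M) :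
    prob p (A ∩ M) ^ 2 ≤
      prob p A * ∑ ω, ∑ ω', weight p ω * weight p ω' *
        ((A ∩ M).indicator 1 ω * (A ∩ M).indicator 1 (mix (run t₂ ω ω') ω ω')) := by
  have h := DTree.cs_aux t₁ t₂ ∅ (fun _ => false) p p h₁ hc (by simpa using ht₂) hp hp
    (fun e he => absurd he (by simp)) (fun e he => absurd he (by simp)) (fun _ _ => rfl)
    (by simpa using hdec) hM
  simpa [expectPair] using h

end PercRepro
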